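import Mathlib
import HarnessLib
import HarnessLib.Audit
import Summits.Parity.Statement
import Summits.Parity.BatemanHorn.Statement
import HarnessLib.Audit.Status.Attr

/-!
Route: RatioProfile

DORMANT since 2026-08-22T17:30:48Z (reconciler: no traction for 5.5 d (last activity item-evidence-added at 2026-08-17T04:19:16Z); parked, not closed — `ledger route dormant route-Parity-RatioProfile --off` to reactivate) — unstaffed, not closed; items shared with open routes are served there. `ledger route dormant <id> --off` reactivates.

# Route RatioProfile — Bateman–Horn from the shape of the almost-prime histogram — ULC ratio
profile, one boundary value, constant by telescoping

For a Bateman–Horn system f = (f_1,…,f_k) (k ≥ 1, P := ∏ f_i, D := ∏ deg f_i, ρ(p) =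
`polyRootCountMod f p`) let
π_x(j) := #{1 ≤ n ≤ x : ω(|P(n)|) = j} be the ALMOST-PRIME HISTOGRAM (its bottom cell j = k is the
prime-tuple count up to
o(x/(log x)^k), support BottomCell), r_j(x) := j·π_x(k+j)/π_x(k+j−1) its LIKELIHOOD-RATIO PROFILE,
L(x) := k·loglog x + log D, and
Λ_x(u) := ∏_{p ≤ x}(1 + (u−1)ρ(p)/p)(1 − 1/p)^{k(u−1)} (so Λ_x(0) = `batemanHornPartial f x` → C(f),
Λ_x(1) = 1). It suffices to show
X = S1 ∧ B ∧ I for every system: (S1 = UltraLogConcave, card K2) r_j(x) is non-increasing (and the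
cells positive) on 1 ≤ j ≤ 2L(x) —
Newton's inequalities without real roots; (B = BoundaryRatioLaw, the sharp form of card K1 "no
boundary layer at k/L → 0") the single
bottom ratio obeys r_1(x) − L(x) − Σ_{p≤x}[ρ(p)/(p−ρ(p)) + k·log(1−1/p)] → kγ; (I =
BulkIncrementLaw, the sharp form of card P3) the
Sathe–Selberg increments log π_x(k+⌊vL⌋) − log π_x(k+⌊uL⌋) between bulk depths 0 < u < v < 2 have
the model value relative to Λ_x.
Then the identity log π_x(k) = log π_x(k+J) − Σ_{i≤J} log(r_i/i), the total mass Σ_j π_x(j) = x and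
Turán–Kubilius (support
VarianceBound) telescope to π_x(k) ~ x·e^{−L}·Λ_x(0) = C(f)·x/(D(log x)^k): the singular series is
OUTPUT, read off as exp(−∫₀¹ g)
for the limit profile g = (log Λ/Γ(1+·)^k)′. Realises card
almost-prime-histogram-ulc-boundary-layer-v2 (spine; its S1, K1 sharpened, P3
sharpened, D1 = no new definition) for ALL systems and with the constant, which the card's own
assembly (Landau in exponent form) lacked.
Lean: `(∀ (k : ℕ) (f : Fin k → Polynomial ℤ), Literature.NumberTheory.Sieve.IsBatemanHornSystem f →
0 < k → let π : ℕ → ℕ → ℕ := fun x j => ((Finset.Icc 1 x).filter (fun n : ℕ =>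
ArithmeticFunction.cardDistinctFactors (∏ i, (f i).eval (n : ℤ)).natAbs = j)).card; let L : ℕ → ℝ :=
fun x => (k : ℝ) * Real.log (Real.log (x : ℝ)) + Real.log (∏ i, ((f i).natDegree : ℝ)); ∀ᶠ x : ℕ in
Filter.atTop, ∀ j : ℕ, 1 ≤ j → (j : ℝ) ≤ 2 * L x → 0 < π x (k + j - 1) ∧ 0 < π x (k + j) ∧ ((j : ℝ)
+ 1) * (π x (k + j - 1) : ℝ) * (π x (k + j + 1) : ℝ) ≤ (j : ℝ) * (π x (k + j) : ℝ) ^ 2) ∧ (∀ (k : ℕ)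
(f : Fin k → Polynomial ℤ), Literature.NumberTheory.Sieve.IsBatemanHornSystem f → 0 < k → let ρ : ℕ
→ ℕ := fun p => Literature.NumberTheory.Sieve.polyRootCountMod f p; let π : ℕ → ℕ → ℕ := fun x j =>
((Finset.Icc 1 x).filter (fun n : ℕ => ArithmeticFunction.cardDistinctFactors (∏ i, (f i).eval (n :
ℤ)).natAbs = j)).card; let L : ℕ → ℝ := fun x => (k : ℝ) * Real.log (Real.log (x : ℝ)) + Real.log (∏
i, ((f i).natDegree : ℝ)); Filter.Tendsto (fun x : ℕ => (π x (k + 1) : ℝ) / (π x k : ℝ) - L x - ∑ p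
∈ Nat.primesLE x, ((ρ p : ℝ) / ((p : ℝ) - ρ p) + (k : ℝ) * Real.log (1 - 1 / (p : ℝ)))) Filter.atTop
(nhds ((k : ℝ) * Real.eulerMascheroniConstant))) ∧ (∀ (k : ℕ) (f : Fin k → Polynomial ℤ),
Literature.NumberTheory.Sieve.IsBatemanHornSystem f → 0 < k → let ρ : ℕ → ℕ := fun p =>
Literature.NumberTheory.Sieve.polyRootCountMod f p; let π : ℕ → ℕ → ℕ := fun x j => ((Finset.Icc 1
x).filter (fun n : ℕ => ArithmeticFunction.cardDistinctFactors (∏ i, (f i).eval (n : ℤ)).natAbs =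
j)).card; let L : ℕ → ℝ := fun x => (k : ℝ) * Real.log (Real.log (x : ℝ)) + Real.log (∏ i, ((f
i).natDegree : ℝ)); let Λ : ℕ → ℝ → ℝ := fun x u => ∏ p ∈ Nat.primesLE x, ((1 + (u - 1) * (ρ p : ℝ)
/ (p : ℝ)) * (1 - 1 / (p : ℝ)) ^ ((k : ℝ) * (u - 1))); ∀ u v : ℝ, 0 < u → u < v → v < 2 →
Filter.Tendsto (fun x : ℕ => Real.log (π x (k + ⌊v * L x⌋₊) : ℝ) - Real.log (π x (k + ⌊u * L x⌋₊) :
ℝ) - ((⌊v * L x⌋₊ : ℝ) - (⌊u * L x⌋₊ : ℝ)) * Real.log (L x) + (Real.log ((⌊v * L x⌋₊).factorial : ℝ)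
- Real.log ((⌊u * L x⌋₊).factorial : ℝ)) - (Real.log (Λ x v) - Real.log (Λ x u))) Filter.atTop (nhds
(-((k : ℝ) * (Real.log (Real.Gamma (1 + v)) - Real.log (Real.Gamma (1 + u)))))))`

## Assembly
Real analysis plus proved tree facts, system by system (k = 0: `polyPrimeCount f x = x + 1`, ρ ≡ 0,
partial products ≡ 1, so
`BatemanHornAsymptotic f` holds with C = 1). Fix a system with k ≥ 1; write e_j(x) := r_j(x) − L(x),
G_x(u) := Λ_x(u)/Γ(1+u)^k,
g_x := (log G_x)′ (equicontinuous on [0,2]: |g_x′| ≤ Σ_p ρ(p)²/(p−ρ(p))² + k·ψ′(1) uniformly in x).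
(1) UltraLogConcave gives, for large x,
positivity of π_x(k+i), 0 ≤ i ≤ 2L, and e_1 ≥ e_2 ≥ … ≥ e_{⌊2L⌋}. (2) BoundaryRatioLaw: e_1(x) =
g_x(0) + o(1). (3) BulkIncrementLaw at the
points of a δ-net of (0, 2−δ): Σ_{J_u<i≤J_v} log(1 + e_i/L) = ∫_u^v g_x + o(1); with (1) this first
bounds e on [1, (2−δ)L] (a block of δL
equal-signed large values would move the sum by ≫ δ·|e|), then log(1+e_i/L) = e_i/L + O(1/L²) turns
block sums into block averages, and
the MONOTONE SANDWICH (a non-increasing sequence whose value at 1 and whose averages over every net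
block converge to those of the
continuous decreasing g_x) yields max_{1≤j≤(2−2δ)L} |e_j(x) − g_x(j/L)| → 0. (4) Summing log(r_i/i)
= log(L/i) + e_i/L + O(1/L²):
π_x(k+j) = π_x(k)·(L^j/j!)·(G_x(j/L)/G_x(0))·e^{o(1)} uniformly for j ≤ (2−2δ)L (Riemann sums of the
equicontinuous g_x). (5) Total
mass: Σ_{j≥0} π_x(j) = x; cells j < k hold O((log x)^{|S|}) values of n (S = the finite set of
resultant / leading-coefficient primes:
some f_i(n) is an S-unit or lies in {0, ±1}); VarianceBound + Chebyshev put all but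
(K/C²)·x of the mass in |j − k − L| ≤ C√L; there G_x(j/L) = G_x(1) + o(1) and the Poisson weights
e^{−L}L^j/j! carry mass ≥ 1 − 1/C²
(Chebyshev for Poisson(L)); hence π_x(k) = x·e^{−L}·(G_x(0)/G_x(1))·(1 + O(1/C²) + o(1)) for every
C, i.e.
π_x(k) ~ x·(log x)^{−k}·D^{−1}·Λ_x(0) (G_x(1) = Λ_x(1)/Γ(2)^k = 1, G_x(0) = Λ_x(0)). (6) Λ_x(0) =
`batemanHornPartial f x` → C(f) =
`batemanHornConst f` > 0 by the PROVED
`Literature.NumberTheory.Sieve.IsBatemanHornSystem.hasBatemanHornConst_holds`; BottomCell and the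
Icc 1 x versus range (x+1) bookkeeping give `polyPrimeCount f x ~ C(f)/D · x/(log x)^k`, i.e.
`BatemanHornAsymptotic f`; quantify over
(k, f): `Literature.NumberTheory.Sieve.BatemanHornConjecture` = `_root_.BatemanHorn`. Deciding
theorem (glue.lean, elaborates sorry-free in
Sketch.lean with axioms propext/Classical.choice/Quot.sound): `closes : UltraLogConcave →
BoundaryRatioLaw → BulkIncrementLaw →
VarianceBound → BottomCell → Assembly → _root_.BatemanHorn := fun h₁ h₂ h₃ h₄ h₅ hA => hA h₁ h₂ h₃
h₄ h₅`.

Rationale: WHY THIS LINE. Mechanism (card almost-prime-histogram-ulc-boundary-layer-v2): carry parity along a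
polynomial system not by zeros or complex
asymptotics of M_x(z) = Σ_n z^{ω(P(n))} (routes LeeYangDisc, AlmostPrimeZeros — drafts;
SelbergDelange — retired not-a-thesis) but by the
ORDER and the VALUES of the real ratio profile r_j(x) of the histogram: the exact identity log
π_x(k) = log π_x(k+J) − Σ_{i≤J} log(r_i/i)
makes the prime-tuple count the bottom of a ladder whose rungs are E_{k+j}-almost-prime ratios, and
the Kubilius/LSD model
(BatemanHornMathComp1962 §2; Selberg's formula Σ_{n≤x} z^{ω(n)} = zF(z)x(log x)^{z−1}, F(z) =
Γ(z+1)^{−1}∏_p(1−1/p)^z(1+z/(p−1)) = our Λ/Γ(1+·) for f = X, Selberg1954 and HallTenenbaum1988 §0.4,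
Ex. 48 p. 77; Tenenbaum2015 II.6) predicts r_j = L + g(j/L) + o(1) with g = (log Λ_f − k·log
Γ(1+·))′, so that
the Bateman–Horn constant is the telescoped integral exp(−∫₀¹ g) = Λ_f(0) — output, not input (as in
RoughValueTransport, but the
deformation parameter is the number of prime factors j/L ∈ [0,1], not the sieve depth u). Imported:
total positivity / ultra-log-concavity
without real roots (BrandenHuh2019, arXiv:0707.2340; Johnson arXiv:math/0603647: ULC ⇒ Poisson
domination) as the COMPACTNESS device — a
monotone profile with prescribed boundary value (B) and prescribed bulk averages (I) is pinned
uniformly (Pólya–Dini sandwich), which is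
exactly the precision (o(1) per rung, averaged over L rungs) that the telescoping needs; the integer
anchor is Balazard's unimodality
theorem doi:10.5802/aif.1213 and Sathe–Selberg (Tenenbaum2015 II.6.1), for which B and I are
theorems (B for f = X is Landau's
π₂(x) = x(loglog x + M + Σ_p 1/(p(p−1)))/log x + o(x/log x)). What prior routes and the negatives
index do not do: no BH route uses
coefficient ORDER of the histogram; the only Parity negative (stmt-Parity-4218, a GHL
rectangle-Chowla) is unrelated; the transfer uses
no zero, no contour, no sieve weight — only products of ratios, Chebyshev and the PROVED
`IsBatemanHornSystem.hasBatemanHornConst_holds`.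

RANKED CRUXES. #2 BoundaryRatioLaw (crux) — (card K1 sharpened: no boundary layer, with its
constant) for every Bateman–Horn system f of k ≥ 1 polynomials, the bottom likelihood ratio r_1(x) =
π_x(k+1)/π_x(k) (E_{k+1}-values over prime tuples) satisfies r_1(x) − (k·loglog x + log ∏deg f_i) −
Σ_{p≤x}[ρ(p)/(p−ρ(p)) + k·log(1−1/p)] → k·γ. For f = (X) this is Landau's theorem (limit γ +
Σ_p[1/(p−1)+log(1−1/p)] = 1.0347); for X²+1 the predicted value of r_1 − loglog x is 1.45 (card:
measured 1.33→1.37 up to 10⁸, rising). [difficulty: open-problem] (why it might fail: j = 1 is the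
E₂-vs-prime comparison along f — prime detection at Landau/HL-E strength (parity-hard); and the
constant presumes the model's 1/Γ(z)^k large-prime factor, i.e. Dickman/Chebyshev–Hooley laws (mean
log deg f_i primes > x per coordinate), open for deg ≥ 2.) [BatemanHornMathComp1962,
HardyLittlewoodPN3, HallTenenbaum1988, Tenenbaum2015, IwaniecInventiones1978, Hooley1967,
Merikoski2022, doi:10.5802/aif.1213]
#3 BulkIncrementLaw (crux) — (card P3 sharpened: Sathe–Selberg increments along f, relative form)
for every system, every 0 < u < v < 2, with J_u = ⌊uL(x)⌋, J_v = ⌊vL(x)⌋: log π_x(k+J_v) − log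
π_x(k+J_u) − (J_v − J_u)·log L(x) + log(J_v!/J_u!) − [log Λ_x(v) − log Λ_x(u)] → −k[log Γ(1+v) − log
Γ(1+u)] (equivalently Σ_{J_u<i≤J_v} log(1 + (r_i − L)/L) → ∫_u^v g). It asserts nothing about cells
with a bounded number of prime factors; for f = (X) it follows from Sathe–Selberg to second order.
[difficulty: open-problem] (why it might fail: local laws at individual cells in the bulk are
destroyed by Selberg's twins 1±λ(P(n)) (period-2 zigzag), so no Type-I input proves any instance for
deg ≥ 2; it contains quantitative ω-Chowla along P (Σ(−1)^{ω(P(n))} = o(x/√L)) and a local Erdős–Kac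
law, both open.) [Selberg1954, HallTenenbaum1988, Tenenbaum2015, NairTenenbaum1998,
HalberstamRichert1974, doi:10.5802/aif.1213]
#4 UltraLogConcave (crux) — (card K2 = S1, with positivity of the cells) for every system and all
large x: for 1 ≤ j ≤ 2L(x), π_x(k+j−1) > 0, π_x(k+j) > 0 and (j+1)·π_x(k+j−1)·π_x(k+j+1) ≤
j·π_x(k+j)², i.e. r_{j+1}(x) ≤ r_j(x): the histogram is ultra-log-concave from the prime cell
through the bulk — Newton's inequalities for the coefficients of M_x(z) although its zeros are
complex. The Kubilius model (real-rooted) has it by Newton; the integer analogue known is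
unimodality (Balazard 1990); card data: true at all 302 sampled x ≤ 10⁸ for ω(n²+1), n²+n+1,
2n²+2n+1, n²+2 (margins r_j − r_{j+1} ∈ [0.07, 1.18]). [difficulty: open-problem] (why it might
fail: bulk margins are only ≍1/L (r_j − r_{j+1} ≈ −g′(j/L)/L): an oscillating secondary term, or a
system with large ρ(p) at tiny p, could flip one inequality at some j ≤ 2L without touching BH; it
is false for Ω beyond ≈2.2L (card data), so ω and the range are load-bearing.) [BrandenHuh2019,
arXiv:0707.2340, arXiv:math/0603647, doi:10.5802/aif.1213]
#9 VarianceBound (support) — Turán–Kubilius along the system (provable now): for every system there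
is K with Σ_{1≤n≤x}(ω(|P(n)|) − L(x))² ≤ K·x·L(x) for all large x. Proof route: truncate ω at y =
x^{1/2} (|P(n)| ≤ Cx^{deg P} has ≤ 2·deg P prime factors > y), expand the square, #{n ≤ x : d |
P(n)} = xρ(d)/d + O(ρ(d)) for squarefree d ≤ x (CRT, multiplicativity of ρ), and Mertens for ρ:
Σ_{p≤y}ρ(p)/p = k·loglog y + O(1) from the PROVED `AZFG2020_tendsto_sum_sub_omega_div_holds` (Σ_p
(k−ρ(p))/p converges). [difficulty: provable-now] [Tenenbaum2015, Kowalski2021,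
HalberstamRichert1974, Elliott1997]
#9 BottomCell (support) — the bottom cell is the prime-tuple count (folklore): for every system with
k ≥ 1, #{1 ≤ n ≤ x : ω(|P(n)|) = k} − polyPrimeCount f x = o(x/(log x)^k). Reason: ω(|P(n)|) = k
forces (primes outside the finite set S of resultant/leading-coefficient primes divide at most one
f_i(n)) either every f_i(n) a prime power of pairwise distinct primes, or some f_i(n) an S-unit;
S-unit values number O((log x)^{|S|}), prime powers f_i(n) = p^a with a > deg f_i number
O(x^{deg/(deg+1)}), and 2 ≤ a ≤ deg f_i number O(x^{1/2+ε}) by Bombieri–Pila (deg 2: Pell conics,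
O(log x)); conversely all-prime tuples lie in the cell except finitely many coincidences f_i(n) =
f_j(n). Lean-hard only in the Bombieri–Pila branch (deg ≥ 3). [difficulty: M] [BombieriPila1989,
HalberstamRichert1974, BatemanHornMathComp1962]

TWO-LAYER PLAN. Foreseen glued splits (none filed now): Assembly ⇐ MonotoneSandwich (pure real
analysis: non-increasing finite sequences with convergent
first value and convergent block averages against an equicontinuous decreasing profile converge
uniformly) → PoissonTelescoping (steps
(4)–(6): Riemann sums, Poisson–Chebyshev window, `hasBatemanHornConst_holds`) → Assembly.
BoundaryRatioLaw ⇐ (existence of the limit of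
r_1 − L) → (identification of the constant via the tilt/mean identity E_x[ω(P(n))] = L + Λ′(1)/Λ(1)
+ kγ + o(1), i.e. the Chebyshev–Hooley
mean of large prime factors) → BoundaryRatioLaw. UltraLogConcave ⇐ (boundary range 1 ≤ j ≤ δL,
parity-hard) → (bulk range δL ≤ j ≤ 2L,
margins 1/L) → UltraLogConcave. BulkIncrementLaw for the integer system f = (X) (Sathe–Selberg to
second order) as a provable special case.

KILL CRITERIA. refuted:UltraLogConcave by an exact histogram of some system at some large x (a
certified decrease-failure r_{j+1} > r_j with j ≤ 2L for
ω, e.g. for an admissible prime k-tuple system with many small-prime roots) forces a PIVOT: replace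
S1 by the uniform profile law
(restate BulkIncrementLaw pointwise-uniform on [1, 2L]) — the telescoping survives, the Newton
flavour dies. refuted:BoundaryRatioLaw (data
for n²+1 or for f = (X, X+2) converging to a boundary value other than kγ after the Λ-subtraction,
certified beyond the 1/L drift) closes
the route outright: the histogram would not telescope to the BH constant along the model profile.
refuted:BulkIncrementLaw likewise
closes it. A proof of BH for all systems elsewhere moots it; a proof of HL-E alone does not.

NOT DECOMPOSED YET. The card's inversion theorem (max-ratio lemma: a Landau counterexample is a
boundary layer or a zigzag), its tilt underdispersion UD and the
conditional upper constant π_{n²+1}(x) ≤ 2.59·(𝔖/2)x/log x — consequences of S1 alone,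
theorem-shaped but not on the path to `closes`;
the f = (X) instances of B and I (Landau / Sathe–Selberg, provable now but PNT-sized in Lean); the
proof principles for S1 (Lorentzian /
strongly Rayleigh structure of the multiaffine occupation polynomial Φ_x(z_p) = Σ_n ∏_{p|P(n)} z_p,
sector conditions on zeros of M_x);
uniformity in f (none claimed); the Ω-variant (exact bottom cell but ULC fails beyond 2.2L). All are
layer-2 or separate cards.

CHEAPEST FALSIFIER. The exact histograms already computed for the card (kit j001028: x ≤ 10⁸, five
quadratics; j001193: 301 log-spaced x ≤ 3·10⁷): (i) S1
margins on 1 ≤ j ≤ 2L — reported positive everywhere for ω (min 0.074); (ii) the boundary value: r_1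
− loglog x = 1.33→1.37 against the
predicted log 2 + γ + Σ_p[ρ/(p−ρ)+log(1−1/p)] = 1.45, drift compatible with the O(1/L) correction
(1/L ≈ 0.35 at 10⁸) — a certified trend
AWAY from 1.45 at 10⁹–10¹⁰ kills B; (iii) new, minutes on the same data: the bulk increment at (u,v)
= (1/2,1) and (1,3/2) after subtracting
log Λ_x, against −k[logΓ(1+v) − logΓ(1+u)] = −log Γ(2)+log Γ(3/2) = −0.1208 and −(log Γ(5/2) − 0) =
−0.2847 (k = 1); and the twin system
(X, X+2) (k = 2, D = 1): π_x(3)/π_x(2) − 2loglog x − Σ_{p≤x}[ρ/(p−ρ) + 2log(1−1/p)] against 2γ =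
1.154. Not run here (plancard seat, no kit).

NUMBERS. Boundary constants c_f := lim (r_1 − loglog x): f = X: γ + Σ_p[1/(p−1)+log(1−1/p)] = 1.0347
(theorem; card measured 1.030); X²+1: 1.45
(card: 1.33→1.37, x ≤ 10⁸); X²+2: 2.87 (card: 2.848); X²+X+1: 0.65 (card: 0.56 rising). ULC margins
for ω(n²+1): 0.07–1.18 at 302 x ≤ 10⁸;
Ω fails ULC beyond ≈2.2L at 300/301 x. Sieve records the line is measured against: upper constant 4
(Selberg/Iwaniec, level x), card's
conditional 2.13–2.59 from UD. Items at open: 6 (3 cruxes, 2 support, 1 assembly).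

DEFINITION REQUESTS. None. π_x(j), r_j, L, Λ_x are finite expressions over Finset.Icc / Nat.primesLE
with ArithmeticFunction.cardDistinctFactors,
Literature.NumberTheory.Sieve.polyRootCountMod, polyPrimeCount, Real.Gamma,
Real.eulerMascheroniConstant (all elaborate, Sketch.lean rc 0).
Cite facts wanted later (not blocking): Halberstam's Erdős–Kac for ω(f(n)) and Landau's π₂
second-order term as Literature facts for the
integer/special-case anchors.

Novelty: Searches (2026-08-15): this seat: `lit search "local laws number of prime divisors of polynomial
sequences Sathe Selberg f(n)"` and
`lit search "Erdos-Kac … omega(f(n)) = k"`, `lit search "Erdős–Kac theorem polynomial values number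
of prime factors local limit"` (searchd
rc 75 ×3, service unavailable all session — grader please re-run these), `lit galaxy search "ultra
log-concave" --star all` (12 rows: Pemantle
arXiv:1210.3231, Brändén–Huh arXiv:1902.03719 ×3, Leake slides, Huh–Schröter–Wang, OWR 17/2015
Kadison–Singer, two surveys — none
number-theoretic), `lit galaxy search "number of prime factors of polynomial values local
distribution" --star all` and `"number of prime
factors of f(n)"` (0 substring hits / daemon queue timeout), held book `lit read
book:hall1988-divisors --grep 'Sathe|local law|unimodal'`
(§0.4 p. 12: Landau 1900 local law, "approximately Poisson — Selberg (1954), Norton, Tenenbaum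
(1980)"; Ex. 48 p. 77: Selberg's formula
and the Sathe–Selberg local law with F = Γ(z+1)^{−1}∏_p(1−1/p)^z(1+z/(p−1)), integers only); ledger:
`ledger negatives --problem Parity`
(1, unrelated), route files of all 20 BatemanHorn theses read for overlap (LeeYangDisc,
AlmostPrimeZeros, SelbergDelange, RoughValueTransport
in full). Inherited from the card (same day, listed there with hit counts): zbMATH 'Balazard
unimodalite' (1), '"ultra log-concave"' (10,
none number-theoretic), 'unimodal log-concave distribution number of prime factors polynomial
sequence' (0), '"inverse sieve"  [refs: 10.5802/aif.1213, 1210.3231, 1902.03719, book:hall1988-divisors, doi:10.5802/aif.1213, Selberg1954, Tenenbaum2015]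

Barriers (technique_class: ulc-newton-inequalities, ratio-profile, tilting): - technique_class: ulc-newton-inequalities, ratio-profile, tilting
- Literature.Barriers.Parity.SelbergParityBarrier: not evaded by the cruxes — conceded: B at j = 1
and every instance of I are destroyed by Selberg's twin measures 1 ± λ(P(n)) (identical Type-I data,
period-2 zigzag of the histogram), so no sieve-theoretic deduction proves them; the bet (card) is
that SHAPE has non-sieve proof principles (Lorentzian/strongly-Rayleigh occupation polynomials,
sector-Newton from zero geometry, Erdős–Nicolas couplings). The TRANSFER is barrier-free: products
of ratios, Chebyshev, a proved Euler-product limit.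
- Literature.Barriers.Parity.LinearSieveOptimality: not engaged — no sieve function or level of
distribution appears; the constant comes from telescoping to Λ_x(0), not from a sieve main term
(likewise WeightedSieveLimit).
- Literature.Barriers.Parity.FordMaynardMinimalTypeII: not applicable — no Type-I/II decomposition
bounds π_x(k); the hypotheses are statements about the multiset {ω(P(n))} that the Ford–Maynard
adversarial (zigzag) sequences violate (likewise FordMaynardLowLevel, FordFixedLevelBarrier).
- Literature.Barriers.Parity.UniformBatemanHornBarrier: uniformity in f is not claimed; every item
is "for each system, as x → ∞".
- Literature.Barriers.Parity.SiegelZeroQuadraticPolynomials: a Granville–Mollin prime-rich quadratic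
at bounded scales is a negative boundary layer (r_1 − L ≪ −1) at those x only; consistent with B as
x → ∞ per f.
- Literature.Barriers.Parity.Fu

History (route lifecycle, newest last):
- 2026-08-22T17:30:48Z · DORMANT — reconciler: no traction for 5.5 d (last activity item-evidence-added at 2026-08-17T04:19:16Z); parked, not closed — `ledger route dormant route-Parity-RatioProf (operator:999:1391484)

sub-problem: BatemanHorn · status: dormant · opened planner-plancard-Parity-BatemanHorn-almost-pr-4eb517d4-0 2026-08-15T15:06:26Z · rev 4 · ledger route-Parity-RatioProfile
GENERATED by the gate from the ledger (D-0016/17). Provers cite these decls: `theorem foo : Summit.Parity.BatemanHorn.Theses.RatioProfile.<Decl> := …` in Summits/Parity/BatemanHorn/Theorems/<Name>.lean.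
-/

namespace Summit.Parity.BatemanHorn.Theses.RatioProfile

open scoped BigOperators Topology Manifold Classical MeasureTheory ProbabilityTheory Matrix InnerProductSpace ComplexConjugate ContinuousMap
open Filter Set Function TopologicalSpace MeasureTheory

attribute [summit_statement] _root_.BatemanHorn

/-- item stmt-Parity-10063 · crux · rank 2 · open · by planner
why it might fail: j = 1 is the E₂-vs-prime comparison along f — prime detection at Landau/HL-E strength (parity-hard); and the constant presumes the model's 1/Γ(z)^k large-prime factor, i.e. Dickman/Chebyshev–Hooley laws (mean log deg f_i primes > x per coordinate), open for deg ≥ 2.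
sources: BatemanHornMathComp1962, HardyLittlewoodPN3, HallTenenbaum1988, Tenenbaum2015, IwaniecInventiones1978, Hooley1967
[crux] (card K1 sharpened: no boundary layer, with its constant) for every Bateman–Horn system f of
k ≥ 1 polynomials, the bottom likelihood ratio r_1(x) = π_x(k+1)/π_x(k) (E_{k+1}-values over prime
tuples) satisfies r_1(x) − (k·loglog x + log ∏deg f_i) − Σ_{p≤x}[ρ(p)/(p−ρ(p)) + k·log(1−1/p)] →
k·γ. For f = (X) this is Landau's theorem (limit γ + Σ_p[1/(p−1)+log(1−1/p)] = 1.0347); for X²+1 the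
predicted value of r_1 − loglog x is 1.45 (card: measured 1.33→1.37 up to 10⁸, rising). [difficulty:
open-problem] -/
@[route_item "route-Parity-RatioProfile", crux]
def BoundaryRatioLaw : Prop :=
  ∀ (k : ℕ) (f : Fin k → Polynomial ℤ), Literature.NumberTheory.Sieve.IsBatemanHornSystem f → 0 < k → let ρ : ℕ → ℕ := fun p => Literature.NumberTheory.Sieve.polyRootCountMod f p; let π : ℕ → ℕ → ℕ := fun x j => ((Finset.Icc 1 x).filter (fun n : ℕ => ArithmeticFunction.cardDistinctFactors (∏ i, (f i).eval (n : ℤ)).natAbs = j)).card; let L : ℕ → ℝ := fun x => (k : ℝ) * Real.log (Real.log (x : ℝ)) + Real.log (∏ i, ((f i).natDegree : ℝ)); Filter.Tendsto (fun x : ℕ => (π x (k + 1) : ℝ) / (π x k : ℝ) - L x - ∑ p ∈ Nat.primesLE x, ((ρ p : ℝ) / ((p : ℝ) - ρ p) + (k : ℝ) * Real.log (1 - 1 / (p : ℝ)))) Filter.atTop (nhds ((k : ℝ) * Real.eulerMascheroniConstant))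

/-- item stmt-Parity-10064 · crux · rank 3 · open · by planner
why it might fail: local laws at individual cells in the bulk are destroyed by Selberg's twins 1±λ(P(n)) (period-2 zigzag), so no Type-I input proves any instance for deg ≥ 2; it contains quantitative ω-Chowla along P (Σ(−1)^{ω(P(n))} = o(x/√L)) and a local Erdős–Kac law, both open.
sources: Selberg1954, HallTenenbaum1988, Tenenbaum2015, NairTenenbaum1998, HalberstamRichert1974, doi:10.5802/aif.1213
[crux] (card P3 sharpened: Sathe–Selberg increments along f, relative form) for every system, every
0 < u < v < 2, with J_u = ⌊uL(x)⌋, J_v = ⌊vL(x)⌋: log π_x(k+J_v) − log π_x(k+J_u) − (J_v − J_u)·log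
L(x) + log(J_v!/J_u!) − [log Λ_x(v) − log Λ_x(u)] → −k[log Γ(1+v) − log Γ(1+u)] (equivalently
Σ_{J_u<i≤J_v} log(1 + (r_i − L)/L) → ∫_u^v g). It asserts nothing about cells with a bounded number
of prime factors; for f = (X) it follows from Sathe–Selberg to second order. [difficulty:
open-problem] -/
@[route_item "route-Parity-RatioProfile", crux]
def BulkIncrementLaw : Prop :=
  ∀ (k : ℕ) (f : Fin k → Polynomial ℤ), Literature.NumberTheory.Sieve.IsBatemanHornSystem f → 0 < k → let ρ : ℕ → ℕ := fun p => Literature.NumberTheory.Sieve.polyRootCountMod f p; let π : ℕ → ℕ → ℕ := fun x j => ((Finset.Icc 1 x).filter (fun n : ℕ => ArithmeticFunction.cardDistinctFactors (∏ i, (f i).eval (n : ℤ)).natAbs = j)).card; let L : ℕ → ℝ := fun x => (k : ℝ) * Real.log (Real.log (x : ℝ)) + Real.log (∏ i, ((f i).natDegree : ℝ)); let Λ : ℕ → ℝ → ℝ := fun x u => ∏ p ∈ Nat.primesLE x, ((1 + (u - 1) * (ρ p : ℝ) / (p : ℝ)) * (1 - 1 / (p : ℝ)) ^ ((k : ℝ)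 * (u - 1))); ∀ u v : ℝ, 0 < u → u < v → v < 2 → Filter.Tendsto (fun x : ℕ => Real.log (π x (k + ⌊v * L x⌋₊) : ℝ) - Real.log (π x (k + ⌊u * L x⌋₊) : ℝ) - ((⌊v * L x⌋₊ : ℝ) - (⌊u * L x⌋₊ : ℝ)) * Real.log (L x) + (Real.log ((⌊v * L x⌋₊).factorial : ℝ) - Real.log ((⌊u * L x⌋₊).factorial : ℝ)) - (Real.log (Λ x v) - Real.log (Λ x u))) Filter.atTop (nhds (-((k : ℝ) * (Real.log (Real.Gamma (1 + v)) - Real.log (Real.Gamma (1 + u))))))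

/-- item stmt-Parity-10065 · crux · rank 4 · open · by planner
why it might fail: bulk margins are only ≍1/L (r_j − r_{j+1} ≈ −g′(j/L)/L): an oscillating secondary term, or a system with large ρ(p) at tiny p, could flip one inequality at some j ≤ 2L without touching BH; it is false for Ω beyond ≈2.2L (card data), so ω and the range are load-bearing.
sources: BrandenHuh2019, arXiv:0707.2340, arXiv:math/0603647, doi:10.5802/aif.1213
[crux] (card K2 = S1, with positivity of the cells) for every system and all large x: for 1 ≤ j ≤
2L(x), π_x(k+j−1) > 0, π_x(k+j) > 0 and (j+1)·π_x(k+j−1)·π_x(k+j+1) ≤ j·π_x(k+j)², i.e. r_{j+1}(x) ≤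
r_j(x): the histogram is ultra-log-concave from the prime cell through the bulk — Newton's
inequalities for the coefficients of M_x(z) although its zeros are complex. The Kubilius model
(real-rooted) has it by Newton; the integer analogue known is unimodality (Balazard 1990); card
data: true at all 302 sampled x ≤ 10⁸ for ω(n²+1), n²+n+1, 2n²+2n+1, n²+2 (margins r_j − r_{j+1} ∈
[0.07, 1.18]). [difficulty: open-problem] -/
@[route_item "route-Parity-RatioProfile", crux]
def UltraLogConcave : Prop :=
  ∀ (k : ℕ) (f : Fin k → Polynomial ℤ), Literature.NumberTheory.Sieve.IsBatemanHornSystem f → 0 < k → let π : ℕ → ℕ → ℕ := fun x j => ((Finset.Icc 1 x).filter (fun n : ℕ => ArithmeticFunction.cardDistinctFactors (∏ i, (f i).eval (n : ℤ)).natAbs = j)).card; let L : ℕ → ℝ := fun x => (k : ℝ) * Real.log (Real.log (x : ℝ)) + Real.log (∏ i, ((f i).natDegree : ℝ)); ∀ᶠ x : ℕ in Filter.atTop, ∀ j : ℕ, 1 ≤ j → (j : ℝ) ≤ 2 * L x → 0 < π x (k + j - 1) ∧ 0 < π x (k + j) ∧ ((j : ℝ) + 1) * (π x (k + j - 1) :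 ℝ) * (π x (k + j + 1) : ℝ) ≤ (j : ℝ) * (π x (k + j) : ℝ) ^ 2

/-- item stmt-Parity-10066 · support · rank 9 · open · by planner
sources: Tenenbaum2015, Kowalski2021, HalberstamRichert1974, Elliott1997
[support] Turán–Kubilius along the system (provable now): for every system there is K with
Σ_{1≤n≤x}(ω(|P(n)|) − L(x))² ≤ K·x·L(x) for all large x. Proof route: truncate ω at y = x^{1/2}
(|P(n)| ≤ Cx^{deg P} has ≤ 2·deg P prime factors > y), expand the square, #{n ≤ x : d | P(n)} =
xρ(d)/d + O(ρ(d)) for squarefree d ≤ x (CRT, multiplicativity of ρ), and Mertens for ρ: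
Σ_{p≤y}ρ(p)/p = k·loglog y + O(1) from the PROVED `AZFG2020_tendsto_sum_sub_omega_div_holds` (Σ_p
(k−ρ(p))/p converges). [difficulty: provable-now] -/
@[route_item "route-Parity-RatioProfile", crux]
def VarianceBound : Prop :=
  ∀ (k : ℕ) (f : Fin k → Polynomial ℤ), Literature.NumberTheory.Sieve.IsBatemanHornSystem f → 0 < k → let L : ℕ → ℝ := fun x => (k : ℝ) * Real.log (Real.log (x : ℝ)) + Real.log (∏ i, ((f i).natDegree : ℝ)); ∃ K : ℝ, ∀ᶠ x : ℕ in Filter.atTop, ∑ n ∈ Finset.Icc 1 x, ((ArithmeticFunction.cardDistinctFactors (∏ i, (f i).eval (n : ℤ)).natAbs : ℝ) - L x) ^ 2 ≤ K * (x : ℝ) * L x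

/-- item stmt-Parity-10067 · support · rank 9 · open · by planner
sources: BombieriPila1989, HalberstamRichert1974, BatemanHornMathComp1962
[support] the bottom cell is the prime-tuple count (folklore): for every system with k ≥ 1, #{1 ≤ n
≤ x : ω(|P(n)|) = k} − polyPrimeCount f x = o(x/(log x)^k). Reason: ω(|P(n)|) = k forces (primes
outside the finite set S of resultant/leading-coefficient primes divide at most one f_i(n)) either
every f_i(n) a prime power of pairwise distinct primes, or some f_i(n) an S-unit; S-unit values
number O((log x)^{|S|}), prime powers f_i(n) = p^a with a > deg f_i number O(x^{deg/(deg+1)}), and 2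
≤ a ≤ deg f_i number O(x^{1/2+ε}) by Bombieri–Pila (deg 2: Pell conics, O(log x)); conversely
all-prime tuples lie in the cell except finitely many coincidences f_i(n) = f_j(n). Lean-hard only
in the Bombieri–Pila branch (deg ≥ 3). [difficulty: M] -/
@[route_item "route-Parity-RatioProfile", crux]
def BottomCell : Prop :=
  ∀ (k : ℕ) (f : Fin k → Polynomial ℤ), Literature.NumberTheory.Sieve.IsBatemanHornSystem f → 0 < k → Asymptotics.IsLittleO Filter.atTop (fun x : ℕ => ((((Finset.Icc 1 x).filter (fun n : ℕ => ArithmeticFunction.cardDistinctFactors (∏ i, (f i).eval (n : ℤ)).natAbs = k)).card : ℝ) - (Literature.NumberTheory.Sieve.polyPrimeCount f x : ℝ))) (fun x : ℕ => (x : ℝ) / Real.log x ^ k)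

/-- item stmt-Parity-10068 · assembly · rank 1 · open · by planner
sources: BatemanHornMathComp1962, Tenenbaum2015, Selberg1954, HardyLittlewoodPN3
[assembly] UltraLogConcave → BoundaryRatioLaw → BulkIncrementLaw → VarianceBound → BottomCell →
BatemanHorn (the monotone sandwich + telescoping + Poisson–Chebyshev transfer above, for every
system; the constant enters only through Λ_x(0) → batemanHornConst f). -/
@[route_item "route-Parity-RatioProfile", crux]
def Assembly : Prop :=
  UltraLogConcave → BoundaryRatioLaw → BulkIncrementLaw → VarianceBound → BottomCell → _root_.BatemanHorn

/-! D-0027 §2.1 — DECIDING THEOREM (planner-authored via `route open/edit --closes-file`; by planner-rrepair-Parity-RatioProfile-ac23e207-g2-0 2026-08-15T17:00:23Z):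
its hypotheses are this route's items and its conclusion the sub-problem Statement (glue_lint), and it elaborates with this file. -/

@[closes "route-Parity-RatioProfile"] theorem closes (h₁ : UltraLogConcave) (h₂ : BoundaryRatioLaw) (h₃ : BulkIncrementLaw) (h₄ : VarianceBound)
    (h₅ : BottomCell) (hA : Assembly) : _root_.BatemanHorn :=
  hA h₁ h₂ h₃ h₄ h₅

end Summit.Parity.BatemanHorn.Theses.RatioProfile
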